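import Summits.QuantumFields.BalabanUV.Beta.CombHId1Torus
import Summits.QuantumFields.BalabanUV.Beta.D1BFx.LiteralStencilSockets

/-!
# `BalabanUV.Beta.CombHId1Record` — binder row D1 (OWNER an2), (J-a) dictionary, item (C2) of TID § F.10 (L2′), part FOUR: **THE `hId₁` CHAIN AT THE RECORD** —
# the three `S`-sockets of `CombHId1Torus.graded_word_eq_sum_perF_e3OfK_comb` DISCHARGED for the (III′) literal's RAW first-order tables `ScombOf tabs cE cVH cΛ j`
# (= `(JsB12CombSh0 …).S j` at `d + 1 = 4`), and THE LEVEL-`(j+1)` SPLIT: the door's graded `hId₁` word at level `j` IS `(cE·wE (j+1))⁻¹ ×` (the coarse-torus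
# first-order table of level `j+1` MINUS its two FRESH insertions — the border `V` and the Λ-sector `SLam`)

WHY.  C2c (`CombHId1Torus`, p342026) proved, for ANY period-covariant bond-localised `S` without `mm` block, that leaf-05 g29's LITERAL graded `hId₁` left side along
`h = Θ·h̄` equals `Σ_a h̄ a • perF M′ (e3OfK Lc (GcombSh Lc j) (dper M ∘ S) ā)|_{coarse ff}`.  JA-TABLE v1.6 Δ6 left OPEN «(iii) the socket lemmas ON the literal's family»
and the READING «`hId₁` ⇔ the level-`(j+1)` first-order table along `h̄` is `c⁻¹ •` the periodised value-function third jet».  This file closes (iii) for the RAW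
tables of the (III′) literal and makes the reading EXACT: by the record's recursion (`RecursiveStencilSlot.SrecOf_succ`)
`S_{j+1} κ′ u′ = (cE·wE (j+1)) • e3OfK Lc (GcombSh Lc j) S_j κ′ u′ + (cVH·wVH (j+1)) • V κ′ u′ + (cΛ·wΛ (j+1)) • SLam Lc (lamCoeffK (KInvStep Lc (j+1)) (E2 (j+1)) Lc) H κ′ u′`,
and periodisation commutes with `e3OfK` (C2b `CombHId1Sandwich.dper_e3OfK`), so on the coarse torus
`(cE·wE (j+1)) • WORD_j(h̄) = T_{j+1}(h̄) − (cVH·wVH (j+1)) • T^V(h̄) − (cΛ·wΛ (j+1)) • T^Λ_{j+1}(h̄)`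
with `T_{j+1}(h̄) := Σ_a h̄ a • perF M′ (dper M′ (S_{j+1} ā))|_{coarse ff}` the level-`(j+1)` first-order table along `h̄` and `T^V`, `T^Λ` the same functionals of the
two FRESH insertions.  So the door's `hId₁ : WORD = c • H′₁` holds at the record with `c = (cE·wE (j+1))⁻¹` EXACTLY when `H′₁` is read as the CHAIN part of the
level-`(j+1)` table; the border and Λ companions are DISPLAYED, not hidden (they are the assembly's «`G` ∕ Λ-companion» rows, memo (31d) (α)).

WHAT ([folklore] finite bookkeeping + absolutely convergent period sums BY NAME; 0 `def`, 0 cited fact, 0 `def … : Prop`, 0 sorry).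
* §1 SOCKETS of `ScombOf tabs cE cVH cΛ j` (generic `d`, any `SymTables`): `periodCov_ScombOf` (M-period covariance from the record's `(St)` via C2a
  `periodCov_of_shiftK_cov`), the localisation is `CombChartStepJets.locStencil_ScombOf` verbatim; `exists_locStencil_SLam_tabs`, `exists_locStencil_e3OfK_ScombOf`.
* §2 **`graded_word_eq_sum_perF_e3OfK_ScombOf`**: C2c's word identity AT THE RECORD's RAW tables, the only table hypothesis left being the `mm`-block vanishing
  `hSmm` (discharged at `d + 1 = 4` in §5 by d1-formalise-leaf-01's `LiteralStencilSockets.JsB12CombSh0_S_inr_inr`).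
* §3 THE LEVEL SPLIT: `dper_add_smul₃` (termwise periodisation of a weighted three-term sum of bi-localised kernels), **`dper_ScombOf_succ`**,
  **`dper_ScombOf_succ_eq_e3OfK_dper`** (with C2b's `dper_e3OfK`), **`perF_dper_ScombOf_succ`** (the torus matrices).
* §4 **`smul_graded_word_eq_table_succ_sub_fresh`**: `(cE·wE (j+1)) • (−(Θᴸ·H₁·Θ) − Ŝ·Q·Θ − Θᴸ·Q′·Ŝ) = T_{j+1}(h̄) − (cVH·wVH (j+1)) • T^V(h̄) − (cΛ·wΛ (j+1)) • T^Λ_{j+1}(h̄)`.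
* §5 `d + 1 = 4`: `JsB12CombSh0_S_eq_ScombOf` (`rfl`), `ScombOf_inr_inr` (any `mm`-free record; feeds §2∕§4 at `JsB12CombSh0 hLc N tabs cΛ cB`) and
  **`smul_graded_word_eq_table_succ_sub_fresh_an1`** (an1's record `symTablesAn1S2 3 Lc cΛ`, NO table hypothesis left).
WHAT THIS IS NOT: not the door's `hId₁` as the consumer binds it (the `(G, S)` pair, `Q′ = Qᵀ`, the index presentation `fμ` and the currency `c` are the
consumer's letters — leaf-05 ∕ leaf-02); not `hId₂`; not (C1); nothing of Bałaban's asserted, valued or discharged; `D1Tel` ∕ `D1Rep` OPEN; 0∕4 row-D1 binders;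
NOT (T-ID), NOT D1, NEVER «G-an2-4 closed», NOT BetaPertH, NOT continuum, NOT Clay.

HONEST DEPENDENCY (page 1, mandatory): continuum YM on T⁴ ⇐ BetaPertH ∧ nine spine estimates (0/9 proved); BetaPertH ⇐ (D1) ∧ (D4) ∧ CAP+tail;
G-an2-4 gates asym, D1 and NE2/3/4.  HONEST FRAMING (cell contract, verbatim): «discharging `BetaPertH` makes Bałaban's UV stability UNCONDITIONAL —
a real constructive-QFT result; it is NOT the continuum limit and NOT the Clay problem.»  ABSOLUTE RULE (cell charter, verbatim): «No internally-minted
statement may enter as a cited fact. Every hypothesis is either kernel-proved in this package or a verbatim quotation of a PUBLISHED theorem with page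
reference. The manuscript(s) under audit are NOT citable for their own disputed steps — they are the thing under adjudication; programme-internal
(2001/route/tribunal) claims are never citable.»  Row D1 OWNER an2 (b2b-balaban-beta-an2) gen 43, 2026-08-22; over C2a∕C2b∕C2c (an2 g42), `CombChartStepJets` (an2 g35),
`RecursiveStencilSlot` (an2 g28), `D1BFx.LiteralStencilSockets` (d1-formalise-leaf-01 g27) BY NAME.  No existing file touched.
-/

noncomputable section

open scoped BigOperators Matrix

namespace Summit.QuantumFields.BalabanUV.Beta.CombHId1Record

open Finset
open Literature.Probability.LatticeModels (Torus.proj)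
open Literature.MathematicalPhysics.QuantumFieldTheory.Balaban1983to89
open Literature.MathematicalPhysics.QuantumFieldTheory.Balaban1983to89.Beta
open B4TorusKernel.MultiPeriod (translate translate_apply)
open B4Sect5Proof (latticeConst latticeConst_nonneg)
open B6Lemma24Torus (pbox)
open ExpKernelCalculus (MKer Decays BiLoc comp)
open AffineAveraging (Site)
open OneStepResolventKernel (Fib LocStencil decays_mono)
open OneStepKernelFamily (vertexOfK KInvStep decays_KInvStep)
open InterLevelTransport (SLam locStencil_SLam)
open BalabanStepJets (locStencil_mono)
open BalabanStepJetsSucc (E2 decays_E2 lamCoeffK abs_lamCoeffK_le wE wVH wΛ)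
open Summit.QuantumFields.BalabanUV.Beta.TameKernelCalculus
open Summit.QuantumFields.BalabanUV.Beta.AxialDressingRooted (axEc one_le_of_neZero)
open Summit.QuantumFields.BalabanUV.Beta.FP.KernelPeriodisationFib (Idx perF perF_apply perZ perZ_apply perF_add perF_smul decays_abs
  translate_invariant_of_shiftK)
open Summit.QuantumFields.BalabanUV.Beta.FP.KernelPeriodisationFibLoc (dper dper_apply summable_dper decays_dper_diag)
open Summit.QuantumFields.BalabanUV.Beta.FP.TorusGaugeCovariancePairing (wrapPt wrapPt_coe)
open Summit.QuantumFields.BalabanUV.Beta.SpineRooted (e3OfK locStencil_e3OfK)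
open Summit.QuantumFields.BalabanUV.Beta.WardLocusRecursive (SrecOf SrecOf_succ)
open Summit.QuantumFields.BalabanUV.Beta.SymmetrisedStepJets (SymTables)
open Summit.QuantumFields.BalabanUV.Beta.CombChartStepJets (GcombSh ScombOf ScombOf_eq ScombOf_translate locStencil_ScombOf decays_GcombSh JsB12CombSh0
  JsB12CombSh0_eq JsComb0Of_S)
open Summit.QuantumFields.BalabanUV.Beta.CombHId1Letters (periodCov_of_shiftK_cov)
open Summit.QuantumFields.BalabanUV.Beta.CombHId1Sandwich (dper_e3OfK)
open Summit.QuantumFields.BalabanUV.Beta.CombHId1Torus (graded_word_eq_sum_perF_e3OfK_comb)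

variable {d : ℕ}

/-! ## §1 The sockets of the RAW comb tables `ScombOf tabs cE cVH cΛ j` -/

section Sockets

variable {Lc : ℕ} [NeZero Lc] (tabs : SymTables d Lc) (cE cVH cΛ : ℝ)

/-- [folklore] **`hSt` AT THE RECORD**: the RAW comb tables are `M`-period covariant on every box with `Lc ∣ M i` (the record's `(St)` letter
`CombChartStepJets.ScombOf_translate` through C2a's bridge `CombHId1Letters.periodCov_of_shiftK_cov`). -/
theorem periodCov_ScombOf (M : Fin (d + 1) → ℕ) (hLM : ∀ i, Lc ∣ M i) (j : ℕ) (κ : Fin (d + 1)) (u m x z : Site (d + 1)) (a b : Fib d) :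
    ScombOf tabs cE cVH cΛ j κ (translate M u m) (translate M x m) (translate M z m) a b = ScombOf tabs cE cVH cΛ j κ u x z a b :=
  periodCov_of_shiftK_cov M (S := ScombOf tabs cE cVH cΛ j) (fun κ u t => ScombOf_translate tabs cE cVH cΛ j κ u t) hLM κ u m x z a b

/-- [folklore] **THE LEVEL-`j` Λ FAMILY OVER ANY TABLE RECORD IS A LOCAL STENCIL FAMILY** (lit-balaban's `locStencil_SLam` fed `abs_lamCoeffK_le` at the common
rate of `decays_KInvStep j`, `decays_E2 j` and the record's (LH) — the Λ-block of an2 g28's `RecursiveStencilSlot.locStencil_SrecOf`, isolated). -/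
theorem exists_locStencil_SLam_tabs (j : ℕ) :
    ∃ C δ : ℝ, 0 ≤ C ∧ 0 < δ ∧ LocStencil (SLam Lc (lamCoeffK (KInvStep (d := d) Lc j) (E2 d Lc j) Lc) tabs.H) C δ := by
  obtain ⟨δA, CA, hδA, hCA, hA⟩ := decays_KInvStep (d := d) (Lc := Lc) j
  obtain ⟨δE, CE, hδE, hCE, hE⟩ := decays_E2 (d := d) (Lc := Lc) j
  set n : ℝ := min δA δE with hn
  have hn0 : 0 < n := lt_min hδA hδE
  have hA' : Decays (KInvStep (d := d) Lc j) CA n := decays_mono hA hCA le_rfl (min_le_left _ _)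
  have hE' : Decays (E2 d Lc j) CE n := decays_mono hE hCE le_rfl (min_le_right _ _)
  have hc := abs_lamCoeffK_le hA' hE' hn0 Lc
  have hn2 : (0 : ℝ) ≤ n / 2 := by positivity
  obtain ⟨Cq, hQ⟩ := tabs.hH (n / 2) hn2
  have h3 := locStencil_SLam (N := Lc) hc hQ (by positivity)
    (mul_nonneg (mul_nonneg (Nat.cast_nonneg _) (mul_nonneg hCA hCE)) (ExpKernelCalculus.Zl_nonneg (by linarith)))
  exact ⟨_, n / 2 / 2, (h3 0 0).nonneg (Sum.inl 0), by positivity, h3⟩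

/-- [folklore] **THE CHAIN PART `e3OfK Lc (GcombSh Lc j) S_j` IS A LOCAL STENCIL FAMILY** (an2's `locStencil_e3OfK` over `locStencil_ScombOf j` and (DG′)). -/
theorem exists_locStencil_e3OfK_ScombOf (j : ℕ) :
    ∃ C δ : ℝ, 0 ≤ C ∧ 0 < δ ∧ LocStencil (e3OfK Lc (GcombSh (d := d) Lc j) (ScombOf tabs cE cVH cΛ j)) C δ := by
  obtain ⟨Cs, δs, hδs, hS⟩ := locStencil_ScombOf tabs cE cVH cΛ j
  obtain ⟨C₁, δ₁, hδ₁, h1⟩ := locStencil_e3OfK (N := Lc) (one_le_of_neZero Lc) (decays_GcombSh (d := d) (Lc := Lc) j) hS hδs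
  exact ⟨C₁, δ₁, (h1 0 0).nonneg (Sum.inl 0), hδ₁, h1⟩

omit [NeZero Lc] in
/-- [folklore] the border table `V` of any record is a local stencil family at rate `1` (the record's (LV)). -/
theorem exists_locStencil_V : ∃ C : ℝ, 0 ≤ C ∧ LocStencil tabs.V C 1 := by
  obtain ⟨C, hC⟩ := tabs.hV 1 zero_le_one
  exact ⟨C, (hC 0 0).nonneg (Sum.inl 0), hC⟩

end Sockets

/-! ## §2 C2c's word identity AT THE RECORD's RAW tables -/

section Word

variable (M : Fin (d + 1) → ℕ) [∀ μ, NeZero (M μ)] {Lc : ℕ} [NeZero Lc] (tabs : SymTables d Lc) (cE cVH cΛ : ℝ)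

set_option synthInstance.maxSize 1024 in
/-- [folklore] **THE DOOR's GRADED `hId₁` WORD AT THE (III′) RECORD's RAW TABLES.**  For `M = Lc·M′`, any level `j`, the RAW first-order tables
`S_j := ScombOf tabs cE cVH cΛ j` of the comb-chart literal (with `mm`-free tables, `hSmm`) and the letters of `CombHId1Torus.graded_word_eq_sum_perF_e3OfK_comb`:
`−(Θᴸ·H₁·Θ) − Ŝ·Q·Θ − Θᴸ·Q′·Ŝ = Σ_a h̄ a • of (a₁ a₂ ↦ perF M′ (e3OfK Lc (GcombSh Lc j) (dper M ∘ S_j) (m a) (ȳ a)) ((ȳ a₁, inl (m a₁)), (ȳ a₂, inl (m a₂))))` — the period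
covariance and the localisation of `S_j` are THEOREMS of the record (§1). -/
theorem graded_word_eq_sum_perF_e3OfK_ScombOf {M' : Fin (d + 1) → ℕ} [∀ μ, NeZero (M' μ)] (hM : ∀ i, M i = Lc * M' i) (j : ℕ)
    (hSmm : ∀ (κ : Fin (d + 1)) (u x z : Site (d + 1)) (m m' : Fin (d + 1)), ScombOf tabs cE cVH cΛ j κ u x z (Sum.inr m) (Sum.inr m') = 0)
    {μ : Type*} [Fintype μ] [DecidableEq μ] (ybar : μ → ↥(pbox M')) (mμ : μ → Fin (d + 1))
    {fμ : μ → Idx M (Fib d)} (hf : fμ = fun a => (wrapPt M ((Lc : ℤ) • (ybar a : Site (d + 1))), Sum.inr (mμ a)))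
    (hfμ : Function.Injective fμ)
    (hcoarse : ∀ (s : ↥(pbox M)) (m : Fin (d + 1)), ((s, Sum.inr m) : Idx M (Fib d)) ∈ Set.range fμ ↔ Torus.proj Lc (s : Site (d + 1)) = 0)
    (hbar : μ → ℝ)
    {Θ : Matrix (↥(pbox M) × Fin (d + 1)) μ ℝ} {ΘL : Matrix μ (↥(pbox M) × Fin (d + 1)) ℝ} {Sh : Matrix μ μ ℝ} {h : ↥(pbox M) × Fin (d + 1) → ℝ}
    (hΘ : Θ = Matrix.of fun (b : ↥(pbox M) × Fin (d + 1)) (a : μ) =>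
      axEc (AveragingContoursRooted.ctr (d + 1) Lc) Lc (b.1 : Site (d + 1)) (b.1 : Site (d + 1)) (Sum.inl b.2) (Sum.inl b.2)
        * perF M (GcombSh (d := d) Lc j) (b.1, Sum.inl b.2) (fμ a))
    (hΘL : ΘL = Matrix.of fun (a : μ) (b : ↥(pbox M) × Fin (d + 1)) =>
      axEc (AveragingContoursRooted.ctr (d + 1) Lc) Lc (b.1 : Site (d + 1)) (b.1 : Site (d + 1)) (Sum.inl b.2) (Sum.inl b.2)
        * perF M (GcombSh (d := d) Lc j) (fμ a) (b.1, Sum.inl b.2))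
    (hSh : Sh = (perF M (GcombSh (d := d) Lc j)).submatrix fμ fμ) (hh : ∀ b, h b = ∑ a, Θ b a * hbar a)
    {H₁ : Matrix (↥(pbox M) × Fin (d + 1)) (↥(pbox M) × Fin (d + 1)) ℝ} {Q : Matrix μ (↥(pbox M) × Fin (d + 1)) ℝ}
    {Q' : Matrix (↥(pbox M) × Fin (d + 1)) μ ℝ}
    (hH₁ : H₁ = ∑ b : ↥(pbox M) × Fin (d + 1), h b • (perF M (dper M (ScombOf tabs cE cVH cΛ j b.2 (b.1 : Site (d + 1))))).submatrix
      (fun b : ↥(pbox M) × Fin (d + 1) => ((b.1, Sum.inl b.2) : Idx M (Fib d))) (fun b : ↥(pbox M) × Fin (d + 1) => ((b.1, Sum.inl b.2) : Idx M (Fib d))))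
    (hQ : Q = ∑ b : ↥(pbox M) × Fin (d + 1), h b • (perF M (dper M (ScombOf tabs cE cVH cΛ j b.2 (b.1 : Site (d + 1))))).submatrix fμ
      (fun b : ↥(pbox M) × Fin (d + 1) => ((b.1, Sum.inl b.2) : Idx M (Fib d))))
    (hQ' : Q' = ∑ b : ↥(pbox M) × Fin (d + 1), h b • (perF M (dper M (ScombOf tabs cE cVH cΛ j b.2 (b.1 : Site (d + 1))))).submatrix
      (fun b : ↥(pbox M) × Fin (d + 1) => ((b.1, Sum.inl b.2) : Idx M (Fib d))) fμ) :
    -(ΘL * H₁ * Θ) - Sh * Q * Θ - ΘL * Q' * Sh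
      = ∑ a, hbar a • Matrix.of fun a₁ a₂ : μ =>
          perF M' (e3OfK Lc (GcombSh (d := d) Lc j) (fun κ u => dper M (ScombOf tabs cE cVH cΛ j κ u)) (mμ a) (ybar a : Site (d + 1)))
            (ybar a₁, Sum.inl (mμ a₁)) (ybar a₂, Sum.inl (mμ a₂)) := by
  have hLM : ∀ i, Lc ∣ M i := fun i => ⟨M' i, hM i⟩
  obtain ⟨CS, δS, hδS, hS⟩ := locStencil_ScombOf tabs cE cVH cΛ j
  exact graded_word_eq_sum_perF_e3OfK_comb M hM j (periodCov_ScombOf tabs cE cVH cΛ M hLM j) hS hδS hSmm ybar mμ hf hfμ hcoarse hbar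
    hΘ hΘL hSh hh hH₁ hQ hQ'

end Word

/-! ## §3 The level-`(j+1)` split of the periodised tables -/

section Split

variable (M : Fin (d + 1) → ℕ) [∀ μ, NeZero (M μ)]

/-- [folklore] **TERMWISE PERIODISATION OF A WEIGHTED THREE-TERM SUM OF BI-LOCALISED KERNELS** (each period sum converges absolutely, `summable_dper`). -/
theorem dper_add_smul₃ {X Y Z : MKer (d + 1) (Fib d)} {pX pY pZ : Site (d + 1)} {CX δX CY δY CZ δZ : ℝ}
    (hX : BiLoc X pX pX CX δX) (hδX : 0 < δX) (hY : BiLoc Y pY pY CY δY) (hδY : 0 < δY) (hZ : BiLoc Z pZ pZ CZ δZ) (hδZ : 0 < δZ)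
    (a b c : ℝ) : dper M (a • X + b • Y + c • Z) = a • dper M X + b • dper M Y + c • dper M Z := by
  funext x y e f
  simp only [dper_apply, Pi.add_apply, Pi.smul_apply, smul_eq_mul]
  have h1 := (summable_dper M hX (hX.nonneg (Sum.inl 0)) hδX x y e f).mul_left a
  have h2 := (summable_dper M hY (hY.nonneg (Sum.inl 0)) hδY x y e f).mul_left b
  have h3 := (summable_dper M hZ (hZ.nonneg (Sum.inl 0)) hδZ x y e f).mul_left c
  rw [(h1.add h2).tsum_add h3, h1.tsum_add h2, tsum_mul_left, tsum_mul_left, tsum_mul_left]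

omit [∀ μ, NeZero (M μ)] in
/-- [folklore] `Decays (A + B) (CA + CB) δ` from `Decays A CA δ`, `Decays B CB δ` (common rate). -/
theorem decays_add' {A B : MKer (d + 1) (Fib d)} {CA CB δ : ℝ} (hA : Decays A CA δ) (hB : Decays B CB δ) : Decays (A + B) (CA + CB) δ :=
  fun x y a b => by
  rw [Pi.add_apply, Pi.add_apply, Pi.add_apply, Pi.add_apply, add_mul]
  exact (abs_add_le _ _).trans (add_le_add (hA x y a b) (hB x y a b))

omit [∀ μ, NeZero (M μ)] in
/-- [folklore] `Decays (c • K) (|c|·C) δ` from `Decays K C δ`. -/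
theorem decays_smul' {K : MKer (d + 1) (Fib d)} {C δ : ℝ} (hK : Decays K C δ) (c : ℝ) : Decays (c • K) (|c| * C) δ := fun x y a b => by
  rw [Pi.smul_apply, Pi.smul_apply, Pi.smul_apply, Pi.smul_apply, smul_eq_mul, abs_mul, mul_assoc]
  exact mul_le_mul_of_nonneg_left (hK x y a b) (abs_nonneg c)

variable {Lc : ℕ} [NeZero Lc] (tabs : SymTables d Lc) (cE cVH cΛ : ℝ)

/-- [folklore] **THE PERIODISED LEVEL-`(j+1)` TABLE SPLITS TERMWISE** along the record's recursion
`S_{j+1} κ′ u′ = (cE·wE (j+1)) • e3OfK Lc (GcombSh Lc j) S_j κ′ u′ + (cVH·wVH (j+1)) • V κ′ u′ + (cΛ·wΛ (j+1)) • SLam Lc (lamCoeffK (KInvStep Lc (j+1)) (E2 (j+1)) Lc) H κ′ u′`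
(`RecursiveStencilSlot.SrecOf_succ` at `G := GcombSh Lc`; each summand bi-localised at `u′`, §1). -/
theorem dper_ScombOf_succ (j : ℕ) (κ' : Fin (d + 1)) (u' : Site (d + 1)) :
    dper M (ScombOf tabs cE cVH cΛ (j + 1) κ' u')
      = (cE * wE d Lc (j + 1)) • dper M (e3OfK Lc (GcombSh (d := d) Lc j) (ScombOf tabs cE cVH cΛ j) κ' u')
        + (cVH * wVH d Lc (j + 1)) • dper M (tabs.V κ' u')
        + (cΛ * wΛ d Lc (j + 1)) • dper M (SLam Lc (lamCoeffK (KInvStep (d := d) Lc (j + 1)) (E2 d Lc (j + 1)) Lc) tabs.H κ' u') := by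
  obtain ⟨C₁, δ₁, -, hδ₁, h1⟩ := exists_locStencil_e3OfK_ScombOf tabs cE cVH cΛ j
  obtain ⟨C₂, -, h2⟩ := exists_locStencil_V tabs
  obtain ⟨C₃, δ₃, -, hδ₃, h3⟩ := exists_locStencil_SLam_tabs tabs (j + 1)
  have hrec : ScombOf tabs cE cVH cΛ (j + 1) κ' u'
      = (cE * wE d Lc (j + 1)) • e3OfK Lc (GcombSh (d := d) Lc j) (ScombOf tabs cE cVH cΛ j) κ' u'
        + (cVH * wVH d Lc (j + 1)) • tabs.V κ' u'
        + (cΛ * wΛ d Lc (j + 1)) • SLam Lc (lamCoeffK (KInvStep (d := d) Lc (j + 1)) (E2 d Lc (j + 1)) Lc) tabs.H κ' u' := by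
    simp only [ScombOf_eq, SrecOf_succ]
  rw [hrec]
  exact dper_add_smul₃ M (h1 κ' u') hδ₁ (h2 κ' u') one_pos (h3 κ' u') hδ₃ _ _ _

/-- [folklore] **… AND ITS CHAIN PART IS THE THIRD JET OF THE PERIODISED LEVEL-`j` TABLES** (C2b `CombHId1Sandwich.dper_e3OfK`: periodisation commutes with `e3OfK`;
`M = Lc·M′`, the comb resolvent `GcombSh Lc j` is `Lcℤ^{d+1}`-invariant and decays, `S_j` is period covariant and bond-localised — §1). -/
theorem dper_ScombOf_succ_eq_e3OfK_dper {M' : Fin (d + 1) → ℕ} [∀ μ, NeZero (M' μ)] (hM : ∀ i, M i = Lc * M' i) (j : ℕ) (κ' : Fin (d + 1))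
    (u' : Site (d + 1)) :
    dper M' (ScombOf tabs cE cVH cΛ (j + 1) κ' u')
      = (cE * wE d Lc (j + 1)) • e3OfK Lc (GcombSh (d := d) Lc j) (fun κ u => dper M (ScombOf tabs cE cVH cΛ j κ u)) κ' u'
        + (cVH * wVH d Lc (j + 1)) • dper M' (tabs.V κ' u')
        + (cΛ * wΛ d Lc (j + 1)) • dper M' (SLam Lc (lamCoeffK (KInvStep (d := d) Lc (j + 1)) (E2 d Lc (j + 1)) Lc) tabs.H κ' u') := by
  have hLM : ∀ i, Lc ∣ M i := fun i => ⟨M' i, hM i⟩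
  obtain ⟨δG, CG, hδG, -, hG⟩ := decays_GcombSh (d := d) (Lc := Lc) j
  have hGinv : ∀ (m x z : Site (d + 1)) (a b : Fib d), GcombSh (d := d) Lc j (translate M x m) (translate M z m) a b = GcombSh (d := d) Lc j x z a b :=
    translate_invariant_of_shiftK M (FP.RelInvPeriodisedComb.shiftK_GcombSh' j) hLM
  obtain ⟨CS, δS, hδS, hS⟩ := locStencil_ScombOf tabs cE cVH cΛ j
  rw [dper_ScombOf_succ M' tabs cE cVH cΛ j κ' u',
    dper_e3OfK (M := M) (N := Lc) hM hGinv hG hδG (periodCov_ScombOf tabs cE cVH cΛ M hLM j) hS hδS κ' u']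

/-- [folklore] **THE COARSE-TORUS MATRICES OF THE LEVEL-`(j+1)` TABLE SPLIT TERMWISE**:
`perF M′ (dper M′ (S_{j+1} κ′ u′)) = (cE·wE (j+1)) • perF M′ (e3OfK Lc (GcombSh Lc j) (dper M ∘ S_j) κ′ u′) + (cVH·wVH (j+1)) • perF M′ (dper M′ (V κ′ u′)) + (cΛ·wΛ (j+1)) • perF M′ (dper M′ (S^Λ_{j+1} κ′ u′))`. -/
theorem perF_dper_ScombOf_succ {M' : Fin (d + 1) → ℕ} [∀ μ, NeZero (M' μ)] (hM : ∀ i, M i = Lc * M' i) (j : ℕ) (κ' : Fin (d + 1))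
    (u' : Site (d + 1)) :
    perF M' (dper M' (ScombOf tabs cE cVH cΛ (j + 1) κ' u'))
      = (cE * wE d Lc (j + 1)) • perF M' (e3OfK Lc (GcombSh (d := d) Lc j) (fun κ u => dper M (ScombOf tabs cE cVH cΛ j κ u)) κ' u')
        + (cVH * wVH d Lc (j + 1)) • perF M' (dper M' (tabs.V κ' u'))
        + (cΛ * wΛ d Lc (j + 1)) • perF M' (dper M' (SLam Lc (lamCoeffK (KInvStep (d := d) Lc (j + 1)) (E2 d Lc (j + 1)) Lc) tabs.H κ' u')) := by
  obtain ⟨C₁, δ₁, hC₁, hδ₁, h1⟩ := exists_locStencil_e3OfK_ScombOf tabs cE cVH cΛ j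
  obtain ⟨C₂, hC₂, h2⟩ := exists_locStencil_V tabs
  obtain ⟨C₃, δ₃, hC₃, hδ₃, h3⟩ := exists_locStencil_SLam_tabs tabs (j + 1)
  have hd1 := decays_smul' (decays_dper_diag M' (h1 κ' u') hC₁ hδ₁) (cE * wE d Lc (j + 1))
  have hd2 := decays_smul' (decays_dper_diag M' (h2 κ' u') hC₂ one_pos) (cVH * wVH d Lc (j + 1))
  have hd3 := decays_smul' (decays_dper_diag M' (h3 κ' u') hC₃ hδ₃) (cΛ * wΛ d Lc (j + 1))
  have hn1 : 0 ≤ |cE * wE d Lc (j + 1)| * (C₁ * latticeConst (d + 1) (δ₁ / 2)) :=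
    mul_nonneg (abs_nonneg _) (mul_nonneg hC₁ (latticeConst_nonneg _ (half_pos hδ₁).le))
  have hn2 : 0 ≤ |cVH * wVH d Lc (j + 1)| * (C₂ * latticeConst (d + 1) (1 / 2)) :=
    mul_nonneg (abs_nonneg _) (mul_nonneg hC₂ (latticeConst_nonneg _ (by norm_num)))
  have hd12 : Decays ((cE * wE d Lc (j + 1)) • dper M' (e3OfK Lc (GcombSh (d := d) Lc j) (ScombOf tabs cE cVH cΛ j) κ' u')
      + (cVH * wVH d Lc (j + 1)) • dper M' (tabs.V κ' u')) _ (min (δ₁ / 2) (1 / 2)) :=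
    decays_add' (decays_mono hd1 hn1 le_rfl (min_le_left _ _)) (decays_mono hd2 hn2 le_rfl (min_le_right _ _))
  have hsplit := dper_ScombOf_succ M' tabs cE cVH cΛ j κ' u'
  have hchain := dper_ScombOf_succ_eq_e3OfK_dper M tabs cE cVH cΛ hM j κ' u'
  rw [hsplit] at hchain
  -- the chain term, identified through `hchain`
  have hE : (cE * wE d Lc (j + 1)) • dper M' (e3OfK Lc (GcombSh (d := d) Lc j) (ScombOf tabs cE cVH cΛ j) κ' u')
      = (cE * wE d Lc (j + 1)) • e3OfK Lc (GcombSh (d := d) Lc j) (fun κ u => dper M (ScombOf tabs cE cVH cΛ j κ u)) κ' u' :=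
    add_right_cancel (add_right_cancel hchain)
  rw [hsplit, perF_add M' hd12 hd3 (lt_min (half_pos hδ₁) (by norm_num)) (half_pos hδ₃),
    perF_add M' hd1 hd2 (half_pos hδ₁) (by norm_num),
    hE, perF_smul, perF_smul, perF_smul]

end Split

/-! ## §4 The door's `hId₁` at the record: the word IS `(cE·wE (j+1))⁻¹ ×` (the level-`(j+1)` table minus its fresh insertions) -/

section HId1

variable (M : Fin (d + 1) → ℕ) [∀ μ, NeZero (M μ)] {Lc : ℕ} [NeZero Lc] (tabs : SymTables d Lc) (cE cVH cΛ : ℝ)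

set_option synthInstance.maxSize 1024 in
/-- [folklore] **THE `hId₁` CHAIN AT THE (III′) RECORD (RAW tables).**  With the letters of §2 (level `j`, `S_j := ScombOf tabs cE cVH cΛ j`, `mm`-free) and the
coarse presentation `g a := (ȳ a, inl (m a))` on the box `M′` (`M = Lc·M′`):
`(cE·wE (j+1)) • (−(Θᴸ·H₁·Θ) − Ŝ·Q·Θ − Θᴸ·Q′·Ŝ) = Σ_a h̄ a • perF M′ (dper M′ (S_{j+1} (m a) (ȳ a)))|_g − (cVH·wVH (j+1)) • Σ_a h̄ a • perF M′ (dper M′ (V (m a) (ȳ a)))|_g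
  − (cΛ·wΛ (j+1)) • Σ_a h̄ a • perF M′ (dper M′ (SLam Lc (lamCoeffK (KInvStep Lc (j+1)) (E2 (j+1)) Lc) H (m a) (ȳ a)))|_g`
— the door's graded `hId₁` word at level `j` IS `(cE·wE (j+1))⁻¹ •` (the coarse-torus first-order table of LEVEL `j+1` along `h̄` MINUS its two FRESH insertions). -/
theorem smul_graded_word_eq_table_succ_sub_fresh {M' : Fin (d + 1) → ℕ} [∀ μ, NeZero (M' μ)] (hM : ∀ i, M i = Lc * M' i) (j : ℕ)
    (hSmm : ∀ (κ : Fin (d + 1)) (u x z : Site (d + 1)) (m m' : Fin (d + 1)), ScombOf tabs cE cVH cΛ j κ u x z (Sum.inr m) (Sum.inr m') = 0)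
    {μ : Type*} [Fintype μ] [DecidableEq μ] (ybar : μ → ↥(pbox M')) (mμ : μ → Fin (d + 1))
    {fμ : μ → Idx M (Fib d)} (hf : fμ = fun a => (wrapPt M ((Lc : ℤ) • (ybar a : Site (d + 1))), Sum.inr (mμ a)))
    (hfμ : Function.Injective fμ)
    (hcoarse : ∀ (s : ↥(pbox M)) (m : Fin (d + 1)), ((s, Sum.inr m) : Idx M (Fib d)) ∈ Set.range fμ ↔ Torus.proj Lc (s : Site (d + 1)) = 0)
    (hbar : μ → ℝ)
    {Θ : Matrix (↥(pbox M) × Fin (d + 1)) μ ℝ} {ΘL : Matrix μ (↥(pbox M) × Fin (d + 1)) ℝ} {Sh : Matrix μ μ ℝ} {h : ↥(pbox M) × Fin (d + 1) → ℝ}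
    (hΘ : Θ = Matrix.of fun (b : ↥(pbox M) × Fin (d + 1)) (a : μ) =>
      axEc (AveragingContoursRooted.ctr (d + 1) Lc) Lc (b.1 : Site (d + 1)) (b.1 : Site (d + 1)) (Sum.inl b.2) (Sum.inl b.2)
        * perF M (GcombSh (d := d) Lc j) (b.1, Sum.inl b.2) (fμ a))
    (hΘL : ΘL = Matrix.of fun (a : μ) (b : ↥(pbox M) × Fin (d + 1)) =>
      axEc (AveragingContoursRooted.ctr (d + 1) Lc) Lc (b.1 : Site (d + 1)) (b.1 : Site (d + 1)) (Sum.inl b.2) (Sum.inl b.2)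
        * perF M (GcombSh (d := d) Lc j) (fμ a) (b.1, Sum.inl b.2))
    (hSh : Sh = (perF M (GcombSh (d := d) Lc j)).submatrix fμ fμ) (hh : ∀ b, h b = ∑ a, Θ b a * hbar a)
    {H₁ : Matrix (↥(pbox M) × Fin (d + 1)) (↥(pbox M) × Fin (d + 1)) ℝ} {Q : Matrix μ (↥(pbox M) × Fin (d + 1)) ℝ}
    {Q' : Matrix (↥(pbox M) × Fin (d + 1)) μ ℝ}
    (hH₁ : H₁ = ∑ b : ↥(pbox M) × Fin (d + 1), h b • (perF M (dper M (ScombOf tabs cE cVH cΛ j b.2 (b.1 : Site (d + 1))))).submatrix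
      (fun b : ↥(pbox M) × Fin (d + 1) => ((b.1, Sum.inl b.2) : Idx M (Fib d))) (fun b : ↥(pbox M) × Fin (d + 1) => ((b.1, Sum.inl b.2) : Idx M (Fib d))))
    (hQ : Q = ∑ b : ↥(pbox M) × Fin (d + 1), h b • (perF M (dper M (ScombOf tabs cE cVH cΛ j b.2 (b.1 : Site (d + 1))))).submatrix fμ
      (fun b : ↥(pbox M) × Fin (d + 1) => ((b.1, Sum.inl b.2) : Idx M (Fib d))))
    (hQ' : Q' = ∑ b : ↥(pbox M) × Fin (d + 1), h b • (perF M (dper M (ScombOf tabs cE cVH cΛ j b.2 (b.1 : Site (d + 1))))).submatrix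
      (fun b : ↥(pbox M) × Fin (d + 1) => ((b.1, Sum.inl b.2) : Idx M (Fib d))) fμ) :
    (cE * wE d Lc (j + 1)) • (-(ΘL * H₁ * Θ) - Sh * Q * Θ - ΘL * Q' * Sh)
      = (∑ a, hbar a • (perF M' (dper M' (ScombOf tabs cE cVH cΛ (j + 1) (mμ a) (ybar a : Site (d + 1))))).submatrix
            (fun a : μ => ((ybar a, Sum.inl (mμ a)) : Idx M' (Fib d))) (fun a : μ => ((ybar a, Sum.inl (mμ a)) : Idx M' (Fib d))))
        - (cVH * wVH d Lc (j + 1)) • (∑ a, hbar a • (perF M' (dper M' (tabs.V (mμ a) (ybar a : Site (d + 1))))).submatrix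
            (fun a : μ => ((ybar a, Sum.inl (mμ a)) : Idx M' (Fib d))) (fun a : μ => ((ybar a, Sum.inl (mμ a)) : Idx M' (Fib d))))
        - (cΛ * wΛ d Lc (j + 1)) • (∑ a, hbar a •
            (perF M' (dper M' (SLam Lc (lamCoeffK (KInvStep (d := d) Lc (j + 1)) (E2 d Lc (j + 1)) Lc) tabs.H (mμ a)
              (ybar a : Site (d + 1))))).submatrix
            (fun a : μ => ((ybar a, Sum.inl (mμ a)) : Idx M' (Fib d))) (fun a : μ => ((ybar a, Sum.inl (mμ a)) : Idx M' (Fib d)))) := by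
  rw [graded_word_eq_sum_perF_e3OfK_ScombOf M tabs cE cVH cΛ hM j hSmm ybar mμ hf hfμ hcoarse hbar hΘ hΘL hSh hh hH₁ hQ hQ']
  have hsplit := fun a : μ => perF_dper_ScombOf_succ M tabs cE cVH cΛ hM j (mμ a) (ybar a : Site (d + 1))
  ext i k
  simp only [Matrix.smul_apply, Matrix.sum_apply, Matrix.sub_apply, Matrix.of_apply, Matrix.submatrix_apply, smul_eq_mul, hsplit,
    Matrix.add_apply, Finset.mul_sum, ← Finset.sum_sub_distrib]
  refine Finset.sum_congr rfl fun a _ => ?_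
  ring

end HId1

/-! ## §5 `d + 1 = 4`: the RAW literal `JsB12CombSh0`, any `mm`-free record, and an1's record with NO table hypothesis left -/

section FourD

open Summit.QuantumFields.BalabanUV.Beta.SymSecondOrderTablesAn1 (symTablesAn1S2)
open Summit.QuantumFields.BalabanUV.Beta.D1BFx.LiteralStencilSockets (JsB12CombSh0_S_inr_inr JsB12CombSh0_S_an1_inr_inr)

variable (M : Fin 4 → ℕ) [∀ μ, NeZero (M μ)] {Lc : ℕ} [NeZero Lc]

/-- [folklore] the RAW (III′) literal's first-order table of member `j` IS `ScombOf tabs (Lc⁴) (−Lc⁸∕2) cΛ j` (`rfl`). -/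
theorem JsB12CombSh0_S_eq_ScombOf (hLc : Odd Lc) (N : ℕ) (tabs : SymTables 3 Lc) (cΛ cB : ℝ) (j : ℕ) :
    (JsB12CombSh0 hLc N tabs cΛ cB j).S = ScombOf tabs ((Lc : ℝ) ^ 4) (-((Lc : ℝ) ^ 8 / 2)) cΛ j := rfl
/-- [folklore] `hSmm` of the RAW literal in the `ScombOf` spelling, for any record whose `V` and `H` are `mm`-free (d1-formalise-leaf-01 g27's
`LiteralStencilSockets.JsB12CombSh0_S_inr_inr` BY NAME). -/
theorem ScombOf_inr_inr (hLc : Odd Lc) (N : ℕ) (tabs : SymTables 3 Lc) (cΛ cB : ℝ)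
    (hVmm : ∀ (κ : Fin 4) (u x y : Fin 4 → ℤ) (m m' : Fin 4), tabs.V κ u x y (Sum.inr m) (Sum.inr m') = 0)
    (hHmm : ∀ (μ : Fin 4) (w x y : Fin 4 → ℤ) (m m' : Fin 4), tabs.H μ w x y (Sum.inr m) (Sum.inr m') = 0)
    (j : ℕ) (κ : Fin 4) (u x z : Site 4) (m m' : Fin 4) :
    ScombOf tabs ((Lc : ℝ) ^ 4) (-((Lc : ℝ) ^ 8 / 2)) cΛ j κ u x z (Sum.inr m) (Sum.inr m') = 0 := by
  rw [← JsB12CombSh0_S_eq_ScombOf hLc N tabs cΛ cB j]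
  exact JsB12CombSh0_S_inr_inr hLc N tabs cΛ cB hVmm hHmm j κ u x z m m'
/-- [folklore] `hSmm` of the RAW literal OF RECORD (an1's tables) in the `ScombOf` spelling. -/
theorem ScombOf_an1_inr_inr (hLc : Odd Lc) (N : ℕ) (cΛ cB : ℝ) (j : ℕ) (κ : Fin 4) (u x z : Site 4) (m m' : Fin 4) :
    ScombOf (symTablesAn1S2 3 Lc cΛ) ((Lc : ℝ) ^ 4) (-((Lc : ℝ) ^ 8 / 2)) cΛ j κ u x z (Sum.inr m) (Sum.inr m') = 0 := by
  rw [← JsB12CombSh0_S_eq_ScombOf hLc N _ cΛ cB j]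
  exact JsB12CombSh0_S_an1_inr_inr hLc N cΛ cB j κ u x z m m'

set_option synthInstance.maxSize 1024 in
/-- [folklore] **THE `hId₁` CHAIN AT THE (III′) LITERAL OF RECORD** (`tabs := symTablesAn1S2 3 Lc cΛ`, pins `(cE, cVH) = (Lc⁴, −Lc⁸∕2)`), NO table hypothesis left:
`(Lc⁴·wE (j+1)) • (−(Θᴸ·H₁·Θ) − Ŝ·Q·Θ − Θᴸ·Q′·Ŝ) = T_{j+1}(h̄) − (−Lc⁸∕2·wVH (j+1)) • T^V(h̄) − (cΛ·wΛ (j+1)) • T^Λ_{j+1}(h̄)` with `T_{j+1}`, `T^V`, `T^Λ` the coarse-torus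
`ff`-tables along `h̄` of the literal's LEVEL-`(j+1)` first-order table and of its two fresh insertions (an1's `symVhSAt ρ_c` border and the Λ-sector over an1's
`symHessFFAt ρ_c`). -/
theorem smul_graded_word_eq_table_succ_sub_fresh_an1 (hLc : Odd Lc) (N : ℕ) (cΛ cB : ℝ)
    {M' : Fin 4 → ℕ} [∀ μ, NeZero (M' μ)] (hM : ∀ i, M i = Lc * M' i) (j : ℕ)
    {μ : Type*} [Fintype μ] [DecidableEq μ] (ybar : μ → ↥(pbox M')) (mμ : μ → Fin 4)
    {fμ : μ → Idx M (Fib 3)} (hf : fμ = fun a => (wrapPt M ((Lc : ℤ) • (ybar a : Site 4)), Sum.inr (mμ a)))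
    (hfμ : Function.Injective fμ)
    (hcoarse : ∀ (s : ↥(pbox M)) (m : Fin 4), ((s, Sum.inr m) : Idx M (Fib 3)) ∈ Set.range fμ ↔ Torus.proj Lc (s : Site 4) = 0)
    (hbar : μ → ℝ)
    {Θ : Matrix (↥(pbox M) × Fin 4) μ ℝ} {ΘL : Matrix μ (↥(pbox M) × Fin 4) ℝ} {Sh : Matrix μ μ ℝ} {h : ↥(pbox M) × Fin 4 → ℝ}
    (hΘ : Θ = Matrix.of fun (b : ↥(pbox M) × Fin 4) (a : μ) =>
      axEc (AveragingContoursRooted.ctr 4 Lc) Lc (b.1 : Site 4) (b.1 : Site 4) (Sum.inl b.2) (Sum.inl b.2)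
        * perF M (GcombSh (d := 3) Lc j) (b.1, Sum.inl b.2) (fμ a))
    (hΘL : ΘL = Matrix.of fun (a : μ) (b : ↥(pbox M) × Fin 4) =>
      axEc (AveragingContoursRooted.ctr 4 Lc) Lc (b.1 : Site 4) (b.1 : Site 4) (Sum.inl b.2) (Sum.inl b.2)
        * perF M (GcombSh (d := 3) Lc j) (fμ a) (b.1, Sum.inl b.2))
    (hSh : Sh = (perF M (GcombSh (d := 3) Lc j)).submatrix fμ fμ) (hh : ∀ b, h b = ∑ a, Θ b a * hbar a)
    {H₁ : Matrix (↥(pbox M) × Fin 4) (↥(pbox M) × Fin 4) ℝ} {Q : Matrix μ (↥(pbox M) × Fin 4) ℝ} {Q' : Matrix (↥(pbox M) × Fin 4) μ ℝ}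
    (hH₁ : H₁ = ∑ b : ↥(pbox M) × Fin 4, h b •
      (perF M (dper M ((JsB12CombSh0 hLc N (symTablesAn1S2 3 Lc cΛ) cΛ cB j).S b.2 (b.1 : Site 4)))).submatrix
      (fun b : ↥(pbox M) × Fin 4 => ((b.1, Sum.inl b.2) : Idx M (Fib 3))) (fun b : ↥(pbox M) × Fin 4 => ((b.1, Sum.inl b.2) : Idx M (Fib 3))))
    (hQ : Q = ∑ b : ↥(pbox M) × Fin 4, h b •
      (perF M (dper M ((JsB12CombSh0 hLc N (symTablesAn1S2 3 Lc cΛ) cΛ cB j).S b.2 (b.1 : Site 4)))).submatrix fμ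
      (fun b : ↥(pbox M) × Fin 4 => ((b.1, Sum.inl b.2) : Idx M (Fib 3))))
    (hQ' : Q' = ∑ b : ↥(pbox M) × Fin 4, h b •
      (perF M (dper M ((JsB12CombSh0 hLc N (symTablesAn1S2 3 Lc cΛ) cΛ cB j).S b.2 (b.1 : Site 4)))).submatrix
      (fun b : ↥(pbox M) × Fin 4 => ((b.1, Sum.inl b.2) : Idx M (Fib 3))) fμ) :
    ((Lc : ℝ) ^ 4 * wE 3 Lc (j + 1)) • (-(ΘL * H₁ * Θ) - Sh * Q * Θ - ΘL * Q' * Sh)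
      = (∑ a, hbar a • (perF M' (dper M' ((JsB12CombSh0 hLc N (symTablesAn1S2 3 Lc cΛ) cΛ cB (j + 1)).S (mμ a) (ybar a : Site 4)))).submatrix
            (fun a : μ => ((ybar a, Sum.inl (mμ a)) : Idx M' (Fib 3))) (fun a : μ => ((ybar a, Sum.inl (mμ a)) : Idx M' (Fib 3))))
        - (-((Lc : ℝ) ^ 8 / 2) * wVH 3 Lc (j + 1)) • (∑ a, hbar a •
            (perF M' (dper M' ((symTablesAn1S2 3 Lc cΛ).V (mμ a) (ybar a : Site 4)))).submatrix
            (fun a : μ => ((ybar a, Sum.inl (mμ a)) : Idx M' (Fib 3))) (fun a : μ => ((ybar a, Sum.inl (mμ a)) : Idx M' (Fib 3))))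
        - (cΛ * wΛ 3 Lc (j + 1)) • (∑ a, hbar a •
            (perF M' (dper M' (SLam Lc (lamCoeffK (KInvStep (d := 3) Lc (j + 1)) (E2 3 Lc (j + 1)) Lc) (symTablesAn1S2 3 Lc cΛ).H (mμ a)
              (ybar a : Site 4)))).submatrix
            (fun a : μ => ((ybar a, Sum.inl (mμ a)) : Idx M' (Fib 3))) (fun a : μ => ((ybar a, Sum.inl (mμ a)) : Idx M' (Fib 3)))) :=
  smul_graded_word_eq_table_succ_sub_fresh M (symTablesAn1S2 3 Lc cΛ) _ _ cΛ hM j (ScombOf_an1_inr_inr hLc N cΛ cB j) ybar mμ hf hfμ hcoarse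
    hbar hΘ hΘL hSh hh hH₁ hQ hQ'

end FourD

end Summit.QuantumFields.BalabanUV.Beta.CombHId1Record

end
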